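import Mathlib
import Summits.Ventures.PercRepro2.ThreeTermPartFibre
import Summits.Ventures.PercRepro2.OneTypedEdge

/-!
# Three-terminal parts, VI b: the abstract pinned core — labelings, abstract states, and the kernel
check of the symmetrised kernel
(blind cell PercRepro2, night-3 g31, 2026-08-30; `proofs/NIGHT3-CERT.md` §40.7)

A pinned core (no typed edge outside the part) is abstracted by a LABELING `f : Fin 6 → Fin 8` of the
six points `o b a₃ t₁ t₂ t₃`: label `0` = in `a₁`'s background cluster, `1` = in `a₂`'s, `2 + w` = in the
neither-cluster whose first point is `w` (`Guard` with the bounds `f v ≤ v + 2` of `lab'`: every label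
`≥ 2` is `2 +` an index carrying it — 3,263 such labelings, one per set partition of the eight points
with `a₁ ≁ a₂`).  For a pattern `i : Fin 8` of the virtual triangle the ABSTRACT STATE `stAbs f i : St`
(the cell's seven Booleans `q', Lo, Ho, Lb, Hb, L3, H3`) is read off `f` through the relation `prelB`
on the terminals generated by the open virtual edges (`pbit`) and the shared labels — the abstract
mirror of `conn_pattern_iff` (ThreeTermPinnedClosure.lean; the bridge is ThreeTermPinnedState.lean).
Every Boolean is an explicit finite loop (`any3`, `all6`, `any6`) so that the kernel evaluates it
directly.

**`pinsym_all`** (kernel `decide`): for every guarded labeling and every sorted triple of representative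
patterns, the SYMMETRISED kernel `Σ_σ KB (stAbs f σ(r,j,k))` is nonnegative — the content of §40.5's
census as a kernel fact.  Own work; standard axioms.
-/

namespace Summit.Ventures.PercRepro2

open ThreeTerm TypedStar CovForm CovForm.OneTyped

namespace Part

section Abstract

/-- Disjunction over `Fin 3`. -/
def any3 (g : Fin 3 → Bool) : Bool := g 0 || g 1 || g 2

/-- Disjunction over `Fin 6`. -/
def any6 (g : Fin 6 → Bool) : Bool := g 0 || g 1 || g 2 || g 3 || g 4 || g 5

/-- Conjunction over `Fin 6`. -/
def all6 (g : Fin 6 → Bool) : Bool := g 0 && g 1 && g 2 && g 3 && g 4 && g 5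

/-- `any3` is the existential. -/
lemma any3_eq_true_iff (g : Fin 3 → Bool) : any3 g = true ↔ ∃ a, g a = true := by
  unfold any3
  simp only [Bool.or_eq_true]
  constructor
  · rintro ((h | h) | h)
    · exact ⟨0, h⟩
    · exact ⟨1, h⟩
    · exact ⟨2, h⟩
  · rintro ⟨a, h⟩
    fin_cases a
    · exact Or.inl (Or.inl h)
    · exact Or.inl (Or.inr h)
    · exact Or.inr h

/-- `any6` is the existential. -/
lemma any6_eq_true_iff (g : Fin 6 → Bool) : any6 g = true ↔ ∃ a, g a = true := by
  unfold any6
  simp only [Bool.or_eq_true]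
  constructor
  · rintro (((((h | h) | h) | h) | h) | h)
    · exact ⟨0, h⟩
    · exact ⟨1, h⟩
    · exact ⟨2, h⟩
    · exact ⟨3, h⟩
    · exact ⟨4, h⟩
    · exact ⟨5, h⟩
  · rintro ⟨a, h⟩
    fin_cases a
    · exact Or.inl (Or.inl (Or.inl (Or.inl (Or.inl h))))
    · exact Or.inl (Or.inl (Or.inl (Or.inl (Or.inr h))))
    · exact Or.inl (Or.inl (Or.inl (Or.inr h)))
    · exact Or.inl (Or.inl (Or.inr h))
    · exact Or.inl (Or.inr h)
    · exact Or.inr h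

/-- `all6` is the universal. -/
lemma all6_eq_true_iff (g : Fin 6 → Bool) : all6 g = true ↔ ∀ a, g a = true := by
  unfold all6
  simp only [Bool.and_eq_true]
  constructor
  · rintro ⟨⟨⟨⟨⟨h0, h1⟩, h2⟩, h3⟩, h4⟩, h5⟩ a
    fin_cases a <;> assumption
  · intro h
    exact ⟨⟨⟨⟨⟨h 0, h 1⟩, h 2⟩, h 3⟩, h 4⟩, h 5⟩

/-- The pattern bit of a pair of terminals: `{0,1} ↦ bit 0` (`e₁`), `{0,2} ↦ bit 1` (`e₂`),
`{1,2} ↦ bit 2` (`e₃`). -/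
def pbit (i : Fin 8) (a b : Fin 3) : Bool :=
  if (a = 0 ∧ b = 1) ∨ (a = 1 ∧ b = 0) then decide (bit 0 i = 1)
  else if (a = 0 ∧ b = 2) ∨ (a = 2 ∧ b = 0) then decide (bit 1 i = 1) else decide (bit 2 i = 1)

/-- The indices of the three terminals among the six points. -/
def tidx : Fin 3 → Fin 6 := ![3, 4, 5]

/-- The abstract step between two terminals: the virtual edge open, or the same label. -/
def pstepB (f : Fin 6 → Fin 8) (i : Fin 8) (a b : Fin 3) : Bool :=
  (a != b && pbit i a b) || (f (tidx a) == f (tidx b))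

/-- The abstract relation: equal, a step, or two steps through a third terminal. -/
def prelB (f : Fin 6 → Fin 8) (i : Fin 8) (a b : Fin 3) : Bool :=
  (a == b) || pstepB f i a b || (pstepB f i a 0 && pstepB f i 0 b) ||
    (pstepB f i a 1 && pstepB f i 1 b) || (pstepB f i a 2 && pstepB f i 2 b)

/-- After pattern `i`, a point of label `l` reaches the root with label `r`. -/
def reachB (f : Fin 6 → Fin 8) (i : Fin 8) (l r : Fin 8) : Bool :=
  (l == r) || any3 fun a => any3 fun b => prelB f i a b && (f (tidx a) == r) && (f (tidx b) == l)

/-- `Q` fails after pattern `i`: a terminal of `a₂`'s cluster is related to one of `a₁`'s. -/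
def qFailB (f : Fin 6 → Fin 8) (i : Fin 8) : Bool :=
  any3 fun a => any3 fun b => prelB f i a b && (f (tidx a) == 1) && (f (tidx b) == 0)

/-- **The abstract state** after pattern `i`. -/
def stAbs (f : Fin 6 → Fin 8) (i : Fin 8) : St :=
  (qFailB f i, reachB f i (f 0) 0, reachB f i (f 0) 1, reachB f i (f 1) 0, reachB f i (f 1) 1,
    reachB f i (f 2) 0, reachB f i (f 2) 1)

/-- A labeling is GUARDED when every label `≥ 2` is `2 +` an index carrying that label. -/
def Guard (f : Fin 6 → Fin 8) : Bool :=
  all6 fun v => !(decide (2 ≤ (f v).val)) || any6 fun w => (w.val + 2 == (f v).val) && (f w == f v)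

/-- `Guard` as a proposition. -/
lemma guard_eq_true_iff (f : Fin 6 → Fin 8) :
    Guard f = true ↔ ∀ v : Fin 6, 2 ≤ (f v).val → ∃ w : Fin 6, w.val + 2 = (f v).val ∧ f w = f v := by
  unfold Guard
  rw [all6_eq_true_iff]
  refine forall_congr' fun v => ?_
  rw [Bool.or_eq_true, Bool.not_eq_true', decide_eq_false_iff_not, any6_eq_true_iff]
  constructor
  · rintro (h | ⟨w, hw⟩)
    · exact fun h' => absurd h' h
    · intro _
      rw [Bool.and_eq_true, beq_iff_eq, beq_iff_eq] at hw
      exact ⟨w, hw⟩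
  · intro h
    by_cases hv : 2 ≤ (f v).val
    · obtain ⟨w, hw1, hw2⟩ := h hv
      exact Or.inr ⟨w, by rw [Bool.and_eq_true, beq_iff_eq, beq_iff_eq]; exact ⟨hw1, hw2⟩⟩
    · exact Or.inl hv

/-- The symmetrised kernel of three states. -/
def symKBS (s₁ s₂ s₃ : St) : ℤ :=
  KB s₁ s₂ s₃ + KB s₁ s₃ s₂ + KB s₂ s₁ s₃ + KB s₂ s₃ s₁ + KB s₃ s₁ s₂ + KB s₃ s₂ s₁

/-- The five representative states of a labeling. -/
def states5 (f : Fin 6 → Fin 8) : St × St × St × St × St :=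
  (stAbs f 0, stAbs f 1, stAbs f 2, stAbs f 4, stAbs f 7)

/-- Picking a representative state. -/
def pick (s : St × St × St × St × St) (r : Fin 5) : St :=
  match r with
  | 0 => s.1
  | 1 => s.2.1
  | 2 => s.2.2.1
  | 3 => s.2.2.2.1
  | 4 => s.2.2.2.2

/-- The check on five states: every sorted triple of representatives has nonnegative symmetrised kernel. -/
def check5 (s : St × St × St × St × St) : Bool :=
  decide (∀ r j k : Fin 5, r ≤ j → j ≤ k → 0 ≤ symKBS (pick s r) (pick s j) (pick s k))

/-- The labeling with the six given labels, the label of point `v` bounded by `v + 2`. -/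
def lab' (f0 : Fin 3) (f1 : Fin 4) (f2 : Fin 5) (f3 : Fin 6) (f4 : Fin 7) (f5 : Fin 8) : Fin 6 → Fin 8 :=
  ![⟨f0.val, by omega⟩, ⟨f1.val, by omega⟩, ⟨f2.val, by omega⟩, ⟨f3.val, by omega⟩, ⟨f4.val, by omega⟩, f5]

end Abstract

end Part

end Summit.Ventures.PercRepro2
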